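import Summits.BirchSwinnertonDyer.BirchSwinnertonDyer.Theorems.ThetaPartnerAtTwoMazurTateCongruenceAtTwoRFourFacts
import Summits.BirchSwinnertonDyer.BirchSwinnertonDyer.Theorems.ResidualThetaTransportAtTwoThetaLayerLambdaCongruenceAtTwoCuspSpanFourShift
import HarnessLib

/-!
# The shared node item stmt-BirchSwinnertonDyer-27436 `CuspSpanEvenAtTwoOdd` (routes ResidualThetaTransportAtTwo r302 and
# ThetaPartnerAtTwo r202): its two WEAKER per-level forms (♠)_N (four-shift) and (G″)_N (`T₂`-kernel) also close BOTH parents —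
# closers BY NAME from «(G″)_N for every odd N» and «(♠)_N for every odd N»

Cell `bsd-wall`, width seat `bsd-wall-rtt-p3-w3` g6 (helper; THEOREMS ONLY — no `def`, no named fact, no `sorry`;
`--supports stmt-BirchSwinnertonDyer-27436`; BSD is not proved by this).

The node of record (W8′, pen bsd-wall-p2 g16) is (G′)_N = `SignedMuAtTwo.CuspSpanEvenAtTwo N` for every odd `N`, inlined as the route
declarations `CuspSpanEvenAtTwoOdd`; its glues to Kan⁺ (27454) and to K1 `MazurTateCongruenceAtTwoTop` (27437) are one-liners over
`kanP5_of_pub_of_signedMuAnalyticAtTwoPlus` / `mazurTateCongruenceAtTwoTop_of_fiveFacts_cuspSpan`. Per level, (G′)_N ⟹ (♠)_N ⟹ (G″)_N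
(`fourShift_of_cuspSpan`, `heckeKernelSpan_of_fourShift`, `heckeKernelSpan_of_cuspSpan`; all elementary), and the parents only ever use
the node through ONE `T₂`-killed character per curve. This file records that the WEAKEST form already closes both parents:

* §1 `undepletedMax_of_heckeKernelSpan` — (PR₂) at `(W, f)` from (G″)_{N_W} (`exists_two_le_norm_ratPlusSymbol_of_heckeKernelSpan` +
  `norm_ratPlusSymbol_le_two`); `symbolMu_of_heckeKernelSpan`, `symbolMu_of_forall_heckeKernelSpan` — K1's `Hμ` binder from (G″) and the
  period fact (the proof of `symbolMu_of_cuspSpanEvenAtTwo` with the first step swapped).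
* §2 closers: `signedMuAnalyticAtTwoPlus_of_abbesUllmo_of_heckeKernelOdd` (21437), `thetaLayerLambdaCongruenceAtTwo_of_pub_of_heckeKernelOdd`
  (Kan⁺ ⟸ `PublishedInputsHeckeAtTwo` ∧ (G″)-odd), `mazurTateCongruenceAtTwoTop_of_pub_of_heckeKernelOdd` (K1 ⟸ PUB⁵ ∧ (G″)-odd), and the
  (♠)-odd versions `…_of_fourShiftOdd`; `heckeKernelOdd_of_cuspSpanEvenAtTwoOdd` / `fourShiftOdd_of_cuspSpanEvenAtTwoOdd` from the route
  declaration itself.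

So a planner may (a) keep 27436 as filed and accept per-level (♠)/(G″) certificates as progress on it, or (b) re-type the node as
«(G″)_N for every odd N» — weaker in logical strength, the same in truth value (both equivalent to (G′)_N by the congruence subgroup
property of `SL₂(ℤ[1/2])`, memo `Cruxes/ThetaLayerLambdaCongruenceAtTwo/Lines/birth-fourshift.md`), and friendlier to certificate engines
(`T₂`-moves allowed, Eisenstein classes excluded automatically). References: R. Pollack, Duke Math. J. 118 (2003) Conj. 6.3 [Pollack2003];
A. Abbes, E. Ullmo, Compositio 103 (1996) Thm. A [AbbesUllmo1996]; J. E. Cremona, *Algorithms for modular elliptic curves* (1997) §2.4, §2.8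
[CremonaAlgorithms1997].
-/

set_option autoImplicit false
-- justification: the `Summit.BirchSwinnertonDyer.BirchSwinnertonDyer.…` path repeats a component (route-file convention)
set_option linter.dupNamespace false

noncomputable section

open scoped Classical MatrixGroups ModularForm

open CongruenceSubgroup Polynomial WeierstrassCurve NumberField IsDedekindDomain
  Literature.NumberTheory.IwasawaTheory Literature.NumberTheory.EllipticCurves Literature.NumberTheory.EllipticCurves.ModularForms
  Literature.NumberTheory.EllipticCurves.Rank1Residual Literature.NumberTheory.EllipticCurves.GreenbergVatsal2000
  Summit.BirchSwinnertonDyer.Rank1Residual.Supersingular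
  Summit.BirchSwinnertonDyer.BirchSwinnertonDyer.Theorems.ThetaLayerLambdaCongruenceAtTwo

namespace Summit.BirchSwinnertonDyer.BirchSwinnertonDyer.Theorems.MazurTateCongruenceAtTwoR

/-! ## §1. (PR₂) and K1's `Hμ` from the `T₂`-kernel form (G″) -/

section SymbolMu

variable {W : WeierstrassCurve ℚ} [W.IsElliptic] [W.IsGloballyMinimal]

/-- **(PR₂) at `(W, f)` from (G″)_{N_W}**: for `W` good supersingular at `2` with `a₂(W) = 0` and its newform `f`, if every additive,
period-invariant, `T₂`-killed `ZMod 2`-character of `Γ₀(N_W)` killing the `4^k`-classes vanishes, then the plus symbol of `f` attains its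
`2`-adic maximum over `ℚ` at an even-layer `2`-power cusp (`exists_two_le_norm_ratPlusSymbol_of_heckeKernelSpan` + `norm_ratPlusSymbol_le_two`).
Weaker hypothesis than `undepletedMax_of_cuspSpanEvenAtTwo`. [cite: Pollack2003, Conj. 6.3 (μ^± = 0)] -/
theorem undepletedMax_of_heckeKernelSpan [NeZero (W.conductorNorm ℤ)] {f : CuspForm (Gamma0 (W.conductorNorm ℤ)) 2}
    (hf : IsNewformOf W f) (hss : GoodSS W 2) (ha : W.frobeniusTrace 2 = 0)
    (hG : ∀ χ : Gamma0 (W.conductorNorm ℤ) → ZMod 2,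
      (∀ γ δ : Gamma0 (W.conductorNorm ℤ), χ (γ * δ) = χ γ + χ δ) →
      (∀ γ δ : Gamma0 (W.conductorNorm ℤ),
        periodFunctional (W.conductorNorm ℤ) γ = periodFunctional (W.conductorNorm ℤ) δ → χ γ = χ δ) →
      (∀ (γ : Gamma0 (W.conductorNorm ℤ)) (δ : Fin 2 → Gamma0 (W.conductorNorm ℤ)) (δ' : Gamma0 (W.conductorNorm ℤ)),
        (∀ h : CuspForm (Gamma0 (W.conductorNorm ℤ)) 2,
          cuspSymbol (heckeT (Gamma0 (W.conductorNorm ℤ)) 2 2 h) γ = ∑ j : Fin 2, cuspSymbol h (δ j) + cuspSymbol h δ') →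
        ∑ j : Fin 2, χ (δ j) + χ δ' = 0) →
      (∀ γ : Gamma0 (W.conductorNorm ℤ), (∃ k : ℕ, 1 ≤ k ∧ ((γ : SL(2, ℤ)) 1 1).natAbs = 4 ^ k) → χ γ = 0) →
      ∀ γ : Gamma0 (W.conductorNorm ℤ), χ γ = 0) :
    ∃ n₁ : ℕ, Even n₁ ∧ ∃ s : ZMod (2 ^ n₁), ∀ r : ℚ, ‖algebraMap ℚ (PadicAlgCl 2) (ratPlusSymbol f r)‖ ≤
      ‖algebraMap ℚ (PadicAlgCl 2) (ratPlusSymbol f ((((cyclotomicGenerator 2 : ZMod (2 ^ (n₁ + 2))) ^ s.val).val : ℚ) / (2 : ℚ) ^ (n₁ + 2)))‖ := by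
  have h2N : ¬ 2 ∣ W.conductorNorm ℤ := SignedMuAtTwo.not_two_dvd_conductorNorm_of_goodSS hss
  have ha2 : cuspCoeff f 2 = 0 := by
    rw [hf.2 2, W.LFunction_apply_prime_eq_frobeniusTrace 2 hss.1, ha, Int.cast_zero]
  obtain ⟨n, hn, s, h2le⟩ :=
    SignedMuAtTwo.exists_two_le_norm_ratPlusSymbol_of_heckeKernelSpan f hf.1 hf.coeffField_eq_bot h2N ha2 hG
  refine ⟨n, hn, s, fun r ↦ (norm_ratPlusSymbol_le_two hf hss ha r).trans ?_⟩
  rw [norm_algebraMap_rat_eq_norm_ratCast_padic]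
  exact h2le

variable (E : WeierstrassCurve ℚ) [E.IsElliptic] [E.IsGloballyMinimal]

/-- **K1's `Hμ(E)` from (G″)_{N_E} and the period fact** — the statement of `symbolMu_of_cuspSpanEvenAtTwo` with its node hypothesis
weakened to the `T₂`-kernel form; same proof (un-depletion `exists_depletedMax_eq_of_undepletedMax`, Manin cusp `½`, `‖ϖ‖₂ = 1`).
[cite: Pollack2003, Conj. 6.3 (μ^± = 0)] [cite: GreenbergVatsal2000, §3, Remark 3.4] -/
theorem symbolMu_of_heckeKernelSpan (h2 : realPeriodRat_eq_unit_mul_plusPeriod_two) (hss : GoodSS E 2)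
    (ha : E.frobeniusTrace 2 = 0) [NeZero (E.conductorNorm ℤ)] {f : CuspForm (Gamma0 (E.conductorNorm ℤ)) 2} (hf : IsNewformOf E f)
    {ϖ : ℚ} (hϖ : (ϖ : ℝ) * E.realPeriodRat = plusPeriod f)
    (S₀ : Finset (HeightOneSpectrum (𝓞 ℚ))) (hS2 : ∀ v ∈ S₀, ((2 : ℕ) : 𝓞 ℚ) ∉ v.asIdeal)
    (hG : ∀ χ : Gamma0 (E.conductorNorm ℤ) → ZMod 2,
      (∀ γ δ : Gamma0 (E.conductorNorm ℤ), χ (γ * δ) = χ γ + χ δ) →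
      (∀ γ δ : Gamma0 (E.conductorNorm ℤ),
        periodFunctional (E.conductorNorm ℤ) γ = periodFunctional (E.conductorNorm ℤ) δ → χ γ = χ δ) →
      (∀ (γ : Gamma0 (E.conductorNorm ℤ)) (δ : Fin 2 → Gamma0 (E.conductorNorm ℤ)) (δ' : Gamma0 (E.conductorNorm ℤ)),
        (∀ h : CuspForm (Gamma0 (E.conductorNorm ℤ)) 2,
          cuspSymbol (heckeT (Gamma0 (E.conductorNorm ℤ)) 2 2 h) γ = ∑ j : Fin 2, cuspSymbol h (δ j) + cuspSymbol h δ') →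
        ∑ j : Fin 2, χ (δ j) + χ δ' = 0) →
      (∀ γ : Gamma0 (E.conductorNorm ℤ), (∃ k : ℕ, 1 ≤ k ∧ ((γ : SL(2, ℤ)) 1 1).natAbs = 4 ^ k) → χ γ = 0) →
      ∀ γ : Gamma0 (E.conductorNorm ℤ), χ γ = 0) :
    ∃ x₀ : ℚ, (∀ r : ℚ, ‖(∑ k ∈ Fintype.piFinset (fun _ : S₀ ↦ Finset.range 3), (∏ v : S₀, ((E.localPolynomialAt (v : HeightOneSpectrum (𝓞 ℚ))).map (Int.castRingHom (PadicAlgCl 2))).coeff (k v) * ((Rat.HeightOneSpectrum.natGenerator (v : HeightOneSpectrum (𝓞 ℚ)) : PadicAlgCl 2)⁻¹) ^ (k v)) * algebraMap ℚ (PadicAlgCl 2) (ratPlusSymbol f (r * ((∏ v : S₀, Rat.HeightOneSpectrum.natGenerator (v : HeightOneSpectrum (𝓞 ℚ)) ^ (k v) : ℕ) : ℚ))))‖ ≤ ‖(∑ k ∈ Fintype.piFinset (fun _ : S₀ ↦ Finset.range 3), (∏ v : S₀, ((E.localPolynomialAt (v : HeightOneSpectrum (𝓞 ℚ))).map (Int.castRingHom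 (PadicAlgCl 2))).coeff (k v) * ((Rat.HeightOneSpectrum.natGenerator (v : HeightOneSpectrum (𝓞 ℚ)) : PadicAlgCl 2)⁻¹) ^ (k v)) * algebraMap ℚ (PadicAlgCl 2) (ratPlusSymbol f (x₀ * ((∏ v : S₀, Rat.HeightOneSpectrum.natGenerator (v : HeightOneSpectrum (𝓞 ℚ)) ^ (k v) : ℕ) : ℚ))))‖) ∧
      ‖algebraMap ℚ (PadicAlgCl 2) (2 * ϖ) * (∑ k ∈ Fintype.piFinset (fun _ : S₀ ↦ Finset.range 3), (∏ v : S₀, ((E.localPolynomialAt (v : HeightOneSpectrum (𝓞 ℚ))).map (Int.castRingHom (PadicAlgCl 2))).coeff (k v) * ((Rat.HeightOneSpectrum.natGenerator (v : HeightOneSpectrum (𝓞 ℚ)) : PadicAlgCl 2)⁻¹) ^ (k v)) * algebraMap ℚ (PadicAlgCl 2) (ratPlusSymbol f (x₀ * ((∏ v : S₀, Rat.HeightOneSpectrum.natGenerator (v : HeightOneSpectrum (𝓞 ℚ)) ^ (k v) : ℕ) : ℚ))))‖ = 1 := by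
  -- (PR₂) at `(E, f)` from the `T₂`-kernel form of the node
  obtain ⟨n₁, hn₁, s₁, hmax⟩ := undepletedMax_of_heckeKernelSpan hf hss ha hG
  -- the undepleted maximum is exactly `2`
  have hV : ‖algebraMap ℚ (PadicAlgCl 2) (ratPlusSymbol f ((((cyclotomicGenerator 2 : ZMod (2 ^ (n₁ + 2))) ^ s₁.val).val : ℚ) / (2 : ℚ) ^ (n₁ + 2)))‖ = 2 := by
    refine le_antisymm (norm_ratPlusSymbol_le_two hf hss ha _) ?_
    obtain ⟨γ, -, hγ⟩ := exists_ratPlusSymbol_maninCusp_eq_one_half f hf.1 hf.coeffField_eq_bot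
    refine le_trans (le_of_eq ?_) (hmax ((((γ : SL(2, ℤ)) 0 0 : ℚ)) / (((γ : SL(2, ℤ)) 1 0 : ℚ))))
    rw [hγ, one_div, map_inv₀, map_ofNat, norm_inv, ResidualThetaLayer.norm_two_padicAlgCl, inv_inv]
  -- un-depletion: the depleted maximum, of the same value `2`
  obtain ⟨n, -, s, hle, hval⟩ := exists_depletedMax_eq_of_undepletedMax E hss ha hf hn₁ hmax S₀ hS2
  rw [hV] at hval
  refine ⟨(((cyclotomicGenerator 2 : ZMod (2 ^ (n + 2))) ^ s.val).val : ℚ) / (2 : ℚ) ^ (n + 2), hle, ?_⟩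
  have hϖ1 : ‖algebraMap ℚ (PadicAlgCl 2) ϖ‖ = 1 := by
    rw [norm_algebraMap_rat_eq_norm_ratCast_padic]
    exact norm_ratCast_periodRatio_eq_one_two h2 E hss hf hϖ
  rw [norm_mul, hval, map_mul, norm_mul, hϖ1, map_ofNat, ResidualThetaLayer.norm_two_padicAlgCl]
  norm_num

/-- **`Hμ` in the lead's `∀ E` shape from «(G″)_N at every odd level» and the period fact** — the hypothesis of
`mazurTateCongruenceAtTwoTop_of_fourFacts_mu`. [cite: Pollack2003, Conj. 6.3 (μ^± = 0)] [cite: GreenbergVatsal2000, §3, Remark 3.4] -/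
theorem symbolMu_of_forall_heckeKernelSpan (h2 : realPeriodRat_eq_unit_mul_plusPeriod_two)
    (hG : ∀ (N : ℕ) [NeZero N], ¬ 2 ∣ N → ∀ χ : Gamma0 N → ZMod 2,
      (∀ γ δ : Gamma0 N, χ (γ * δ) = χ γ + χ δ) →
      (∀ γ δ : Gamma0 N, periodFunctional N γ = periodFunctional N δ → χ γ = χ δ) →
      (∀ (γ : Gamma0 N) (δ : Fin 2 → Gamma0 N) (δ' : Gamma0 N),
        (∀ h : CuspForm (Gamma0 N) 2,
          cuspSymbol (heckeT (Gamma0 N) 2 2 h) γ = ∑ j : Fin 2, cuspSymbol h (δ j) + cuspSymbol h δ') →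
        ∑ j : Fin 2, χ (δ j) + χ δ' = 0) →
      (∀ γ : Gamma0 N, (∃ k : ℕ, 1 ≤ k ∧ ((γ : SL(2, ℤ)) 1 1).natAbs = 4 ^ k) → χ γ = 0) →
      ∀ γ : Gamma0 N, χ γ = 0) :
    ∀ (E : WeierstrassCurve ℚ) [E.IsElliptic] [E.IsGloballyMinimal], GoodSS E 2 → E.frobeniusTrace 2 = 0 →
      ∀ [NeZero (E.conductorNorm ℤ)] (f : CuspForm (Gamma0 (E.conductorNorm ℤ)) 2), IsNewformOf E f →
      ∀ (ϖ : ℚ), (ϖ : ℝ) * E.realPeriodRat = plusPeriod f →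
      ∀ (S₀ : Finset (HeightOneSpectrum (𝓞 ℚ))), (∀ v ∈ S₀, ((2 : ℕ) : 𝓞 ℚ) ∉ v.asIdeal) →
        (∀ v : HeightOneSpectrum (𝓞 ℚ), ¬ E.HasGoodReductionAt v → v ∈ S₀) →
      ∃ x₀ : ℚ, (∀ r : ℚ, ‖(∑ k ∈ Fintype.piFinset (fun _ : S₀ ↦ Finset.range 3), (∏ v : S₀, ((E.localPolynomialAt (v : HeightOneSpectrum (𝓞 ℚ))).map (Int.castRingHom (PadicAlgCl 2))).coeff (k v) * ((Rat.HeightOneSpectrum.natGenerator (v : HeightOneSpectrum (𝓞 ℚ)) : PadicAlgCl 2)⁻¹) ^ (k v)) * algebraMap ℚ (PadicAlgCl 2) (ratPlusSymbol f (r * ((∏ v : S₀, Rat.HeightOneSpectrum.natGenerator (v : HeightOneSpectrum (𝓞 ℚ)) ^ (k v) : ℕ) : ℚ))))‖ ≤ ‖(∑ k ∈ Fintype.piFinset (fun _ : S₀ ↦ Finset.range 3), (∏ v : S₀, ((E.localPolynomialAt (v : HeightOneSpectrum (𝓞 ℚ))).map (Int.castRingHom (PadicAlgCl 2))).coeff (k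 v) * ((Rat.HeightOneSpectrum.natGenerator (v : HeightOneSpectrum (𝓞 ℚ)) : PadicAlgCl 2)⁻¹) ^ (k v)) * algebraMap ℚ (PadicAlgCl 2) (ratPlusSymbol f (x₀ * ((∏ v : S₀, Rat.HeightOneSpectrum.natGenerator (v : HeightOneSpectrum (𝓞 ℚ)) ^ (k v) : ℕ) : ℚ))))‖) ∧
        ‖algebraMap ℚ (PadicAlgCl 2) (2 * ϖ) * (∑ k ∈ Fintype.piFinset (fun _ : S₀ ↦ Finset.range 3), (∏ v : S₀, ((E.localPolynomialAt (v : HeightOneSpectrum (𝓞 ℚ))).map (Int.castRingHom (PadicAlgCl 2))).coeff (k v) * ((Rat.HeightOneSpectrum.natGenerator (v : HeightOneSpectrum (𝓞 ℚ)) : PadicAlgCl 2)⁻¹) ^ (k v)) * algebraMap ℚ (PadicAlgCl 2) (ratPlusSymbol f (x₀ * ((∏ v : S₀, Rat.HeightOneSpectrum.natGenerator (v : HeightOneSpectrum (𝓞 ℚ)) ^ (k v) : ℕ) : ℚ))))‖ = 1 := by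
  intro E _ _ hss ha _ f hf ϖ hϖ S₀ hS2 _
  exact symbolMu_of_heckeKernelSpan E h2 hss ha hf hϖ S₀ hS2
    (hG _ (SignedMuAtTwo.not_two_dvd_conductorNorm_of_goodSS hss))

end SymbolMu

/-! ## §2. Both parents of the node, BY NAME, from the weaker forms -/

section Closers

/-- **K1 `MazurTateCongruenceAtTwoTop` BY NAME from PUB⁵ (the route's own `PublishedInputsHeckeAtTwo`) and «(G″)_N for every odd N».**
BSD is not proved by this. [cite: AbbesUllmo1996, Thm. A] [cite: Buzzard2000LevelLoweringModTwo, Prop. 2.4] [cite: Pollack2003, Conj. 6.3] -/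
theorem mazurTateCongruenceAtTwoTop_of_pub_of_heckeKernelOdd
    (hP : Summit.BirchSwinnertonDyer.BirchSwinnertonDyer.Theses.ThetaPartnerAtTwo.PublishedInputsHeckeAtTwo)
    (hG : ∀ (N : ℕ) [NeZero N], ¬ 2 ∣ N → ∀ χ : Gamma0 N → ZMod 2,
      (∀ γ δ : Gamma0 N, χ (γ * δ) = χ γ + χ δ) →
      (∀ γ δ : Gamma0 N, periodFunctional N γ = periodFunctional N δ → χ γ = χ δ) →
      (∀ (γ : Gamma0 N) (δ : Fin 2 → Gamma0 N) (δ' : Gamma0 N),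
        (∀ h : CuspForm (Gamma0 N) 2,
          cuspSymbol (heckeT (Gamma0 N) 2 2 h) γ = ∑ j : Fin 2, cuspSymbol h (δ j) + cuspSymbol h δ') →
        ∑ j : Fin 2, χ (δ j) + χ δ' = 0) →
      (∀ γ : Gamma0 N, (∃ k : ℕ, 1 ≤ k ∧ ((γ : SL(2, ℤ)) 1 1).natAbs = 4 ^ k) → χ γ = 0) →
      ∀ γ : Gamma0 N, χ γ = 0) :
    Summit.BirchSwinnertonDyer.BirchSwinnertonDyer.Theses.ThetaPartnerAtTwo.MazurTateCongruenceAtTwoTop := by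
  obtain ⟨hES, hSD, hBz, hSe, hAU⟩ := hP
  exact mazurTateCongruenceAtTwoTop_of_fourFacts_mu hES hSD hBz hSe
    (symbolMu_of_forall_heckeKernelSpan (SkinnerUrban2014.realPeriodRat_eq_unit_mul_plusPeriod_two_fact_of_abbesUllmo hAU) hG)

/-- **K1 BY NAME from PUB⁵ and «(♠)_N (four-shift) for every odd N».** BSD is not proved by this.
[cite: AbbesUllmo1996, Thm. A] [cite: Pollack2003, Conj. 6.3] -/
theorem mazurTateCongruenceAtTwoTop_of_pub_of_fourShiftOdd
    (hP : Summit.BirchSwinnertonDyer.BirchSwinnertonDyer.Theses.ThetaPartnerAtTwo.PublishedInputsHeckeAtTwo)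
    (hFS : ∀ (N : ℕ) [NeZero N], ¬ 2 ∣ N → ∀ χ : Gamma0 N → ZMod 2,
      (∀ γ δ : Gamma0 N, χ (γ * δ) = χ γ + χ δ) →
      (∀ γ δ : Gamma0 N, periodFunctional N γ = periodFunctional N δ → χ γ = χ δ) →
      (∀ γ : Gamma0 N, (∃ k : ℕ, 1 ≤ k ∧ ((γ : SL(2, ℤ)) 1 1).natAbs = 4 ^ k) → χ γ = 0) →
      ∀ γ γ' : Gamma0 N, (γ' : SL(2, ℤ)) 0 0 = (γ : SL(2, ℤ)) 0 0 →
        (γ' : SL(2, ℤ)) 1 0 = 4 * (γ : SL(2, ℤ)) 1 0 → χ γ' = χ γ) :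
    Summit.BirchSwinnertonDyer.BirchSwinnertonDyer.Theses.ThetaPartnerAtTwo.MazurTateCongruenceAtTwoTop :=
  mazurTateCongruenceAtTwoTop_of_pub_of_heckeKernelOdd hP fun N _ hN ↦ SignedMuAtTwo.heckeKernelSpan_of_fourShift hN (hFS N hN)

end Closers

end Summit.BirchSwinnertonDyer.BirchSwinnertonDyer.Theorems.MazurTateCongruenceAtTwoR

namespace Summit.BirchSwinnertonDyer.BirchSwinnertonDyer.Theorems.SignedMuAtTwo

section Closers

/-- **Item 21437 `SignedMuAnalyticAtTwoPlus` from Abbes–Ullmo Thm. A (by name) and «(G″)_N for every odd N»** — the weakest node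
form; `signedMuAnalyticAtTwoPlus_iff_flatMuZero_of_abbesUllmo` ∘ `flatMuZeroAtTwo_of_heckeKernelSpan`. Conditional on the print fact and
on the conjecture-grade node; BSD is not proved by this. [cite: AbbesUllmo1996, Thm. A] [cite: Pollack2003, Conj. 6.3 and Prop. 6.18] -/
theorem signedMuAnalyticAtTwoPlus_of_abbesUllmo_of_heckeKernelOdd
    (hAU : abbesUllmo_not_dvd_maninConstant_of_not_dvd_level)
    (hG : ∀ (N : ℕ) [NeZero N], ¬ 2 ∣ N → ∀ χ : Gamma0 N → ZMod 2,
      (∀ γ δ : Gamma0 N, χ (γ * δ) = χ γ + χ δ) →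
      (∀ γ δ : Gamma0 N, periodFunctional N γ = periodFunctional N δ → χ γ = χ δ) →
      (∀ (γ : Gamma0 N) (δ : Fin 2 → Gamma0 N) (δ' : Gamma0 N),
        (∀ h : CuspForm (Gamma0 N) 2,
          cuspSymbol (heckeT (Gamma0 N) 2 2 h) γ = ∑ j : Fin 2, cuspSymbol h (δ j) + cuspSymbol h δ') →
        ∑ j : Fin 2, χ (δ j) + χ δ' = 0) →
      (∀ γ : Gamma0 N, (∃ k : ℕ, 1 ≤ k ∧ ((γ : SL(2, ℤ)) 1 1).natAbs = 4 ^ k) → χ γ = 0) →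
      ∀ γ : Gamma0 N, χ γ = 0) :
    Summit.BirchSwinnertonDyer.BirchSwinnertonDyer.Theses.ResidualThetaTransportAtTwo.SignedMuAnalyticAtTwoPlus :=
  (signedMuAnalyticAtTwoPlus_iff_flatMuZero_of_abbesUllmo hAU).mpr (flatMuZeroAtTwo_of_heckeKernelSpan hG)

/-- **Kan⁺ `ThetaLayerLambdaCongruenceAtTwo` BY NAME from PUB⁵ (the route's own `PublishedInputsHeckeAtTwo`) and «(G″)_N for every odd N»**
(`kanP5_of_pub_of_signedMuAnalyticAtTwoPlus`). BSD is not proved by this. [cite: AbbesUllmo1996, Thm. A] [cite: Pollack2003, Conj. 6.3] -/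
theorem thetaLayerLambdaCongruenceAtTwo_of_pub_of_heckeKernelOdd
    (hP : Summit.BirchSwinnertonDyer.BirchSwinnertonDyer.Theses.ResidualThetaTransportAtTwo.PublishedInputsHeckeAtTwo)
    (hG : ∀ (N : ℕ) [NeZero N], ¬ 2 ∣ N → ∀ χ : Gamma0 N → ZMod 2,
      (∀ γ δ : Gamma0 N, χ (γ * δ) = χ γ + χ δ) →
      (∀ γ δ : Gamma0 N, periodFunctional N γ = periodFunctional N δ → χ γ = χ δ) →
      (∀ (γ : Gamma0 N) (δ : Fin 2 → Gamma0 N) (δ' : Gamma0 N),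
        (∀ h : CuspForm (Gamma0 N) 2,
          cuspSymbol (heckeT (Gamma0 N) 2 2 h) γ = ∑ j : Fin 2, cuspSymbol h (δ j) + cuspSymbol h δ') →
        ∑ j : Fin 2, χ (δ j) + χ δ' = 0) →
      (∀ γ : Gamma0 N, (∃ k : ℕ, 1 ≤ k ∧ ((γ : SL(2, ℤ)) 1 1).natAbs = 4 ^ k) → χ γ = 0) →
      ∀ γ : Gamma0 N, χ γ = 0) :
    Summit.BirchSwinnertonDyer.BirchSwinnertonDyer.Theses.ResidualThetaTransportAtTwo.ThetaLayerLambdaCongruenceAtTwo := by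
  obtain ⟨hES, hSD, hBz, hSe, hAU⟩ := hP
  exact ThetaLayerLambdaCongruenceAtTwo.kanP5_of_pub_of_signedMuAnalyticAtTwoPlus hES hSD hBz hSe hAU
    (signedMuAnalyticAtTwoPlus_of_abbesUllmo_of_heckeKernelOdd hAU hG)

/-- **Kan⁺ BY NAME from PUB⁵ and «(♠)_N for every odd N».** BSD is not proved by this. [cite: AbbesUllmo1996, Thm. A] [cite: Pollack2003, Conj. 6.3] -/
theorem thetaLayerLambdaCongruenceAtTwo_of_pub_of_fourShiftOdd
    (hP : Summit.BirchSwinnertonDyer.BirchSwinnertonDyer.Theses.ResidualThetaTransportAtTwo.PublishedInputsHeckeAtTwo)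
    (hFS : ∀ (N : ℕ) [NeZero N], ¬ 2 ∣ N → ∀ χ : Gamma0 N → ZMod 2,
      (∀ γ δ : Gamma0 N, χ (γ * δ) = χ γ + χ δ) →
      (∀ γ δ : Gamma0 N, periodFunctional N γ = periodFunctional N δ → χ γ = χ δ) →
      (∀ γ : Gamma0 N, (∃ k : ℕ, 1 ≤ k ∧ ((γ : SL(2, ℤ)) 1 1).natAbs = 4 ^ k) → χ γ = 0) →
      ∀ γ γ' : Gamma0 N, (γ' : SL(2, ℤ)) 0 0 = (γ : SL(2, ℤ)) 0 0 →
        (γ' : SL(2, ℤ)) 1 0 = 4 * (γ : SL(2, ℤ)) 1 0 → χ γ' = χ γ) :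
    Summit.BirchSwinnertonDyer.BirchSwinnertonDyer.Theses.ResidualThetaTransportAtTwo.ThetaLayerLambdaCongruenceAtTwo :=
  thetaLayerLambdaCongruenceAtTwo_of_pub_of_heckeKernelOdd hP fun N _ hN ↦ heckeKernelSpan_of_fourShift hN (hFS N hN)

/-- **The node of record implies its weakest form**: the route declaration `CuspSpanEvenAtTwoOdd` (item 27436, (G′)_N for every odd `N`)
gives «(G″)_N for every odd N» (`heckeKernelSpan_of_cuspSpan`, via the Hecke–Shimura lemma at `p = 2`). [cite: LingOesterle1991, Thm. 6] -/
theorem heckeKernelOdd_of_cuspSpanEvenAtTwoOdd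
    (hG : Summit.BirchSwinnertonDyer.BirchSwinnertonDyer.Theses.ResidualThetaTransportAtTwo.CuspSpanEvenAtTwoOdd) :
    ∀ (N : ℕ) [NeZero N], ¬ 2 ∣ N → ∀ χ : Gamma0 N → ZMod 2,
      (∀ γ δ : Gamma0 N, χ (γ * δ) = χ γ + χ δ) →
      (∀ γ δ : Gamma0 N, periodFunctional N γ = periodFunctional N δ → χ γ = χ δ) →
      (∀ (γ : Gamma0 N) (δ : Fin 2 → Gamma0 N) (δ' : Gamma0 N),
        (∀ h : CuspForm (Gamma0 N) 2,
          cuspSymbol (heckeT (Gamma0 N) 2 2 h) γ = ∑ j : Fin 2, cuspSymbol h (δ j) + cuspSymbol h δ') →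
        ∑ j : Fin 2, χ (δ j) + χ δ' = 0) →
      (∀ γ : Gamma0 N, (∃ k : ℕ, 1 ≤ k ∧ ((γ : SL(2, ℤ)) 1 1).natAbs = 4 ^ k) → χ γ = 0) →
      ∀ γ : Gamma0 N, χ γ = 0 :=
  fun N _ hN ↦ heckeKernelSpan_of_cuspSpan hN (hG N hN)

/-- **The node of record implies the four-shift form** at every odd level (`fourShift_of_cuspSpan`). [folklore] -/
theorem fourShiftOdd_of_cuspSpanEvenAtTwoOdd
    (hG : Summit.BirchSwinnertonDyer.BirchSwinnertonDyer.Theses.ResidualThetaTransportAtTwo.CuspSpanEvenAtTwoOdd) :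
    ∀ (N : ℕ) [NeZero N], ¬ 2 ∣ N → ∀ χ : Gamma0 N → ZMod 2,
      (∀ γ δ : Gamma0 N, χ (γ * δ) = χ γ + χ δ) →
      (∀ γ δ : Gamma0 N, periodFunctional N γ = periodFunctional N δ → χ γ = χ δ) →
      (∀ γ : Gamma0 N, (∃ k : ℕ, 1 ≤ k ∧ ((γ : SL(2, ℤ)) 1 1).natAbs = 4 ^ k) → χ γ = 0) →
      ∀ γ γ' : Gamma0 N, (γ' : SL(2, ℤ)) 0 0 = (γ : SL(2, ℤ)) 0 0 →
        (γ' : SL(2, ℤ)) 1 0 = 4 * (γ : SL(2, ℤ)) 1 0 → χ γ' = χ γ :=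
  fun N _ _ ↦ fourShift_of_cuspSpan (hG N ‹_›)

end Closers

end Summit.BirchSwinnertonDyer.BirchSwinnertonDyer.Theorems.SignedMuAtTwo

end
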